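import Mathlib
import Literature.MathematicalPhysics.QuantumFieldTheory.Balaban1983to89.B10LogDet63

/-!
# `Balaban1983to89.B10Eq63Rep` — [Balaban1985UV3] p. 272, the paragraph after (63): the generalized random walk
# REPRESENTATION of `G̃₃(x)` typed as a leaf with its two missing clauses, and the sentence *"By the above formula
# this gives an expansion of the last integral in (63) into a sum of gauge invariant, localized terms"* — the
# interchange `∫₀^{2γ₁} Σ_ω = Σ_ω ∫₀^{2γ₁}` — kernel-checked from it

T. Bałaban, *Ultraviolet stability of three-dimensional lattice pure gauge field theories*, Commun. Math. Phys. **102**,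
255–275 (1985) [Balaban1985UV3] (cell paper B10; PDF `paper:balaban1985-cmp102-uv-stability-3d`, journal page = PDF
page + 254; render `1985-cmp102-uv-stability-3d-p018-x2.png` of p. 272 READ AS IMAGE for this module).  Consumer for
d = 4: T. Bałaban, *Renormalization group approach to lattice gauge field theories. II*, Commun. Math. Phys. **116**,
1–22 (1988) [Balaban1988RG2Cluster], p. 13 (2.7) (render `1988-cmp116-rg-II-cluster-p013-x2.png` READ AS IMAGE).
Sibling of `…Balaban1983to89.B10LogDet63` ((61)–(63) at operator level; the x-UNIFORM walk-term bound typed as the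
hypothesis `G3WalkBound`; the bookkeeping `logHalfBound_integral63`), which this module imports and does not modify.

WHY THIS MODULE (cell GAPS C-adv4-61, referee adv4 pass 33, 2026-08-19 — owner response of the b10 lineage).  The
referee's hostile re-read of the typed leaf found two corrections: (1) the x-RANGE on which the representation of
`G̃₃(x)` is consumed is COMPACT — `[0, 2γ₁]` for the first integral of (63) (*"The number γ₁ is an upper bound of the
positive, bounded operator C*Δ_kC"*), `[0, γ₁]` with the integrable weight `x^{−1/2}` for the first integral of
[Balaban1988RG2Cluster] (2.7) — never `[0, ∞)` (the tails are the power series); (2) the typed leaf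
`B10LogDet63.G3WalkBound` (`∀ x ∈ [0,a], |term x b ω| ≤ K q^{|ω|} e^{−r d(dom b ω)}`) carries NO representation clause
and NO regularity in `x`, so the print's step *"this gives an expansion of the last integral in (63)"* —
`∫₀^{2γ₁} dx (C*Δ_kC + xI)⁻¹(b,b) = ∫₀^{2γ₁} Σ_ω term_ω(x) = Σ_ω ∫₀^{2γ₁} term_ω(x) dx` — is NOT a consequence of the
leaf as typed (a `term` non-measurable in `x` satisfies `G3WalkBound`; `logHalfBound_integral63` stays sound as a
BOUND because Mathlib's interval integral of a non-integrable function is `0`).  The referee's ruling: the leaf must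
read (α) REPRESENTATION on the compact interval, (β) CONTINUITY (or measurability) of each walk term in `x` there,
(γ) the x-uniform bound; given (α)–(γ) the interchange is a theorem (dominated convergence), and (β) is available for
the print's terms (finite products of local resolvents, continuous in `x ≥ 0`).  This module types (α) and (β) next to
(γ) and proves exactly that, with the same abstract, d-independent vocabulary as `B10LogDet63` §3 (cubes `Q` with
`≤ Dg` neighbours, sites `S` with `≤ V` per cube, walks `B9Thm37Sum.walksFrom`, localization domains `LocDomainSys`,
spaces `sp X`).  The generic interchange lemmas of §1 re-prove, inside the tree, the shapes of the referee's scratch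
file `b2b-balaban-adv4/g33/B10Interchange63.lean` (kernel rc 0 there; credited, not imported — scratch files are not
tree modules).

CITATION HEADER (lean-in-tree rule).  WHAT IS REPRODUCED, verbatim from the renders, in §0 below: the two sentences of
p. 272 on `G̃₃(x)` and the expansion of the last integral in (63); the first term of (63) p. 272; the sentence on `γ₁`;
from [Balaban1988RG2Cluster] p. 13 the display (2.7) and the two sentences after it on `G̃₃(x)`.

WHAT IS KERNEL-CERTIFIED (theorems about finite sums, countable series, interval integrals and real symmetric
matrices — no object of the papers is constructed):
* §1 — DOMINATED INTERCHANGE on a compact interval `[0, a]` with an integrable scalar weight `w` (w ≡ 1 for (63),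
  `w = x^{−1/2}` for (2.7)): a countable family `F i` continuous on `[0,a]` with summable uniform bounds and pointwise
  sums `f x` has `Σ_i ∫₀^a w·F i = ∫₀^a w·f` (`hasSum_integral_smul_of_dominated`, `hasSum_integral_of_dominated`,
  `integral_tsum_of_dominated`); `∫₀^a x^{−1/2} dx = 2a^{1/2}` and `‖∫₀^a x^{−1/2}·g‖ ≤ 2a^{1/2}·C` for `|g| ≤ C`
  (`integral_rpow_neg_half`, `norm_integral_rpow_smul_le`).
* §2 — THE LEAF, typed: (α) `G3Rep` — for every `x ∈ [0,a]`, every site `b` and every configuration of a set `𝒰`, the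
  datum `R x b φ` (the resolvent entry `(C*Δ_k(U)C + xI)⁻¹(b,b)`, or its difference with the `U_{k+1} = 1` entry) IS the
  sum of its walk terms, level by level: `HasSum (n ↦ Σ_{|ω| = n} term x b ω φ) (R x b φ)`; (β) `G3Cont` — each walk
  term is continuous in `x` on `[0,a]` on the space of its localization domain; (γ) = `B10LogDet63.G3WalkBound`
  (imported).  Hypotheses only; nothing of the series is asserted.  §2b: a representation as ONE unconditional sum
  over the type of all walks (the referee's `Σ_ω term_ω(x) = R`) implies the level-wise (α) (`g3Rep_of_hasSum_sigma`,
  finite fibres), and under (γ) with `r ≥ 0`, `Dg·q < 1` the two are EQUIVALENT (`summable_sigma_of_walkBound`,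
  `hasSum_sigma_of_g3Rep`) — (α) is kept in the formally weaker level-wise form.
* §3 — GIVEN (β)+(γ) (and the counting hypotheses of `B10LogDet63.norm_level_le`, `Dg·q < 1`): the levels and the
  localized pieces `Elog X` of `B10LogDet63` are continuous in `x` (`continuousOn_level`, `continuousOn_Elog`) and
  COMMUTE WITH THE x-INTEGRAL — `Elog(∫₀^a w·term) X = ∫₀^a w·Elog(term x) X` on `sp X` (`level_integral_smul_eq`,
  `hasSum_integral_smul_level`, `Elog_integral_smul_eq`; w ≡ 1: `level_integral_eq`, `Elog_integral_eq`); GIVEN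
  (α)+(β)+(γ): per site `Σ_n Σ_{|ω|=n} ∫₀^a w·term = ∫₀^a w·R x b` (`hasSum_integral_smul_R`, `hasSum_integral_R`), the
  pointwise resummation `Σ_b R x b = Σ_X Elog(term x) X` (`sum_R_eq_sum_Elog`, through `B10LogDet63.sum_Elog_eq`) and
  the integrated one `∫₀^a w·Σ_b R x b dx = Σ_X Elog(∫₀^a w·term) X` (`integral_smul_sum_R_eq`, `integral_sum_R_eq`) —
  i.e. the x-integrated resolvent trace IS the sum of the x-integrated localized pieces, each of which obeys the
  per-cube shape `B13.LogHalfBound` by the imported `B10LogDet63.logHalfBound_integral63` (w ≡ 1, constant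
  `a·K·V/(1 − Dg·q)`) resp. by `logHalfBound_integral27` here (w = x^{−1/2}, constant `2a^{1/2}·K·V/(1 − Dg·q)`).
* §4 — THE PRINTED SENTENCE for a positive definite real symmetric matrix `T φ` indexed by the sites (the operator
  `C*Δ_k(U)C` in the variables Ã), with `R x b φ = (x·1 + T φ)⁻¹(b,b)`: `∫₀^a Tr(x·1 + T φ)⁻¹ dx = Σ_X Elog(∫₀^a term) X φ`
  (`integral_trace_resolvent_eq_sum_Elog`) and, composed with `B10LogDet63.matrix63` at `a = 2γ₁`, the LOCALIZED form
  of (63): `−½ log det T = ½ Σ_X Elog(∫₀^{2γ₁} term) X − ½ log(2γ₁)·Tr I + Σ_{n≥1}((−1)ⁿ/2n)(2γ₁)⁻ⁿ Tr Tⁿ`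
  (`matrix63_localized`); and, composed with the tree's entrywise (2.7) `B13Sqrt27.invSqrt_apply_eq_split` at
  `a = γ₁`, the LOCALIZED form of (2.7): `(T^{−1/2})_{ij} = π⁻¹·Σ_n Σ_{|ω|=n} ∫₀^{γ₁} x^{−1/2}·term x b ω dx + π⁻¹·Σ_m
  ((−1)^m/(m+½)) γ₁^{−m−½}(T^m)_{ij}` when the entry `(x·1 + T)⁻¹_{ij}` is the datum of site `b` (`sqrt27_localized`) —
  *"This yields an expansion of the integral above, hence an expansion of (C^{(k)})^{1/2} also"* (p. 13).
* §5 — CLAUSE (β) IS DISCHARGEABLE for terms of the printed kind: `x ↦ (x·1 + T)⁻¹` is continuous on `[0, ∞)` for `T`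
  positive definite (`continuousOn_resolvent`, adjugate/determinant), hence so are its entries and finite products of
  entries of such resolvents (`continuousOn_resolvent_apply`, `continuousOn_prod_resolvent_entries`), and a `term`
  continuous on `[0, ∞)` for every configuration satisfies `G3Cont` on every `[0,a]` (`g3Cont_of_Ici`).

WHAT IS NOT CERTIFIED (named leaves = hypotheses of the theorems; cell GAPS rows in brackets): (α) that `G̃₃(x)`, hence
`(C*Δ_k(U)C + xI)⁻¹(b,b′)`, HAS the generalized random walk representation for `x ∈ [0, 2γ₁]` (resp. `[0, γ₁]`) — *"The
operator G̃₃(x) has the same properties as G̃₂, especially it can be represented by a generalized random walk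
expansion"*, asserted by analogy with [5] Sect. B–E [G-IF-10, G-B10-06, G-B10-12 (i); typed `G3Rep`]; (γ) the
(23)-type bounds UNIFORM in `x` on that COMPACT interval [G-IF-10; typed `B10LogDet63.G3WalkBound`] — NOT on `[0, ∞)`
(C-adv4-61 (1): the x ≥ 2γ₁ resp. x ≥ γ₁ part is the power series of (63) resp. (2.7), kernel `B10LogDet63.matrix63` /
`B13Sqrt27.invSqrt_apply_eq_split`); (β) for the ACTUAL terms of the expansion (only the mechanism of §5 is certified: the actual terms
are finite products of localized inverses `(x·(local term) + local operator)⁻¹` sandwiched by bounded operators, p. 272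
and [5] (3.183)–(3.185), which are not constructed here); gauge invariance of the terms; the upper bound `γ₁`
[C-IF-07 (E2)]; the identification of the abstract cubes / sites / domains / tree length with the paper's (DIVERGENCE
F5).  ABSOLUTE RULE: (α), (β), (γ) enter only as hypotheses (`G3Rep`, `G3Cont`, `G3WalkBound` binders); no sentence of
the paper under audit is used as a fact.  Value = the typed leaf sharpened by two clauses + kernel certificate of the
print's interchange step, NOT summit progress; d = 3 in the paper, every statement here is d-independent.

REVISION v1.1 (same seat, after the pre-landing XREAD of v1 by an outside adversarial reader — cell GAPS C-adv2-58,
verdict ok, objections 0, three records-only remarks): R1 — the locator of the display (63) and of the sentence on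
`γ₁` corrected from «p. 271 [PDF 17]» to p. 272 [PDF 18] (the paragraph introducing (61)–(63) starts on p. 271; the
render of p. 272 re-read as image); R2 — §2b added: the level-wise form of (α) versus one unconditional sum over all
walks (equivalent under (γ)); R3 — unchanged and documented: the consequences of §3–§4 need the configuration in
every space `sp X` (inherited from `B10LogDet63.sum_Elog_eq`).  No statement of v1 changed.

## References
* [Balaban1985UV3] T. Bałaban, Commun. Math. Phys. 102 (1985) 255–275, (63) p. 272 and the paragraph after it,
  (23) p. 262.
* [Balaban1988RG2Cluster] T. Bałaban, Commun. Math. Phys. 116 (1988) 1–22, (2.7) p. 13 and the paragraph after it.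
* [Balaban1985BackgroundPropagators] T. Bałaban, Commun. Math. Phys. 99 (1985) 389–434 (= [5] of the paper, [13] of the
  consumer), (3.108), (3.183)–(3.185) — named as the DAG edge behind (α)/(γ), not used.
-/

noncomputable section

open MeasureTheory Set Filter Matrix Finset intervalIntegral
open scoped Real Topology

namespace Literature.MathematicalPhysics.QuantumFieldTheory.Balaban1983to89.B10Eq63Rep

open Literature.MathematicalPhysics.QuantumFieldTheory.Balaban1983to89

/-! ## §0. The printed text — quoted (p. 272 of [Balaban1985UV3]; p. 13 of [Balaban1988RG2Cluster])

(63) p. 272 [PDF 18] (the paragraph introducing (61)–(63) starts on p. 271), first term, verbatim: `½ log det(C*Δ_kC)⁻¹ = ½∫₀^{2γ₁} dx Tr(C*Δ_kC + xI)⁻¹ − …`, after *"The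
number γ₁ is an upper bound of the positive, bounded operator C*Δ_kC. Hence the integral above can be written as a sum
of two integrals, and we have"* (the full display and the cell's misprint record are quoted in `B10LogDet63` §0).

p. 272 [PDF 18], verbatim: *"The operator under the integral has a representation similar to (C*Δ_kC)⁻¹. More exactly
the operator C(C*Δ_kC + xI)⁻¹C* is represented by the integral (3.183) [5] with the additional term
−½x‖χ̃(QA + D̄μ(QA))‖² under the exponential function, where χ̃ is the characteristic function of the set of bonds
corresponding to variables Ã. This term determines a non-negative, bounded and almost local operator. The integral
yields the representation analogous to (3.185)* `(C*Δ_kC + xI)⁻¹ = (I + D̄μ)QG̃₃(x)Q*(I + μ*D̄*)↾_{B(Λ_{k+1})}`, *where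
G̃₃(x) is defined as G̃₂, but with this additional operator. The operator G̃₃(x) has the same properties as G̃₂,
especially it can be represented by a generalized random walk expansion. By the above formula this gives an expansion
of the last integral in (63) into a sum of gauge invariant, localized terms. They are again analyzed in the way
described before."*

[Balaban1988RG2Cluster] p. 13 [PDF 13], verbatim: *"To expand the last operator we use a method similar to the method
of Sect. C [16]. There it was applied to expand the determinant of this operator, see (63) [16]. Now we can simplify it
a bit using a better decay property of an underintegral function, and we have*
`(C^{(k)})^{1/2} = (C*Δ_kC)^{−1/2} = (1/π)∫₀^∞ dx x^{−1/2}(xI + C*Δ_kC)⁻¹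
 = (1/π)∫₀^{γ₁} dx x^{−1/2}(xI + C*Δ_kC)⁻¹ + Σ_{n=0}^∞ ((−1)ⁿ/(n + 1/2)) γ₁^{−n−1/2}(C*Δ_kC)ⁿ.` (2.7) ⟦sic: the
series term lacks the factor `1/π` — cell DIVERGENCE D-b13.3, kernel `B13Sqrt27.eq27_as_printed_false`⟧
*Expanding the operator Δ_k into the generalized random walks, we obtain an expansion of the series above, if γ₁ is
sufficiently large. The resolvent (xI + C*Δ_kC)⁻¹ has a representation similar to (C*Δ_kC)⁻¹. […] The integral
yields the representation (3.185) [13], with the operator G̃₂ replaced by G̃₃(x), which is defined as G̃₂, but with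
this additional operator. The operator G̃₃(x) has the same properties as G̃₂, especially it can be expanded into a
generalized random walk expansion. This yields an expansion of the integral above, hence an expansion of (C^{(k)})^{1/2}
also."* ([16] = [Balaban1985UV3], [13] = [Balaban1985BackgroundPropagators].) -/

/-! ## §1. Dominated interchange of a countable sum and the integral over a compact x-interval -/
section interchange

variable {E : Type*} [NormedAddCommGroup E] [NormedSpace ℝ E]

/-- **Dominated interchange with an integrable weight.**  On `[0, a]`: a countable family `F i` of functions continuous
on `[0,a]` with uniform bounds `‖F i x‖ ≤ c i`, `Σ c i < ∞`, summing pointwise to `f x`, and a scalar weight `w`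
interval-integrable on `[0,a]`; then `Σ_i ∫₀^a w x • F i x dx = ∫₀^a w x • f x dx` as a `HasSum`
(Mathlib `intervalIntegral.hasSum_integral_of_dominated_convergence` with the bound `‖w x‖·c i`). [folklore] -/
theorem hasSum_integral_smul_of_dominated {ι : Type*} [Countable ι] {F : ι → ℝ → E} {f : ℝ → E} {a : ℝ}
    (ha : 0 ≤ a) {w : ℝ → ℝ} (hw : IntervalIntegrable w volume 0 a) (c : ι → ℝ)
    (hF : ∀ i, ContinuousOn (F i) (Icc 0 a)) (hb : ∀ i, ∀ x ∈ Icc 0 a, ‖F i x‖ ≤ c i) (hc : Summable c)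
    (hlim : ∀ x ∈ Icc 0 a, HasSum (fun i => F i x) (f x)) :
    HasSum (fun i => ∫ x in (0 : ℝ)..a, w x • F i x) (∫ x in (0 : ℝ)..a, w x • f x) := by
  have hsub : Set.uIoc (0 : ℝ) a ⊆ Icc 0 a := by rw [uIoc_of_le ha]; exact Ioc_subset_Icc_self
  refine intervalIntegral.hasSum_integral_of_dominated_convergence (fun i x => ‖w x‖ * c i)
    (fun i => ?_) (fun i => ?_) ?_ ?_ ?_
  · rw [uIoc_of_le ha]
    have hw1 : AEStronglyMeasurable w (volume.restrict (Ioc 0 a)) := hw.1.aestronglyMeasurable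
    exact hw1.smul (((hF i).mono Ioc_subset_Icc_self).aestronglyMeasurable measurableSet_Ioc)
  · exact Filter.Eventually.of_forall fun x hx => by
      rw [norm_smul]
      exact mul_le_mul_of_nonneg_left (hb i x (hsub hx)) (norm_nonneg _)
  · exact Filter.Eventually.of_forall fun x _ => hc.mul_left _
  · have h : (fun x => ∑' i, ‖w x‖ * c i) = fun x => ‖w x‖ * ∑' i, c i := by
      funext x; exact tsum_mul_left
    rw [h]
    exact hw.norm.mul_const _
  · exact Filter.Eventually.of_forall fun x hx => (hlim x (hsub hx)).const_smul (w x)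

/-- **Dominated interchange**, weight `w ≡ 1`: `Σ_i ∫₀^a F i = ∫₀^a f` for continuous `F i` with summable uniform
bounds summing pointwise to `f` on `[0,a]`. [folklore] -/
theorem hasSum_integral_of_dominated {ι : Type*} [Countable ι] {F : ι → ℝ → E} {f : ℝ → E} {a : ℝ} (ha : 0 ≤ a)
    (c : ι → ℝ) (hF : ∀ i, ContinuousOn (F i) (Icc 0 a)) (hb : ∀ i, ∀ x ∈ Icc 0 a, ‖F i x‖ ≤ c i)
    (hc : Summable c) (hlim : ∀ x ∈ Icc 0 a, HasSum (fun i => F i x) (f x)) :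
    HasSum (fun i => ∫ x in (0 : ℝ)..a, F i x) (∫ x in (0 : ℝ)..a, f x) := by
  simpa only [one_smul] using hasSum_integral_smul_of_dominated (F := F) (f := f) ha (w := fun _ => (1 : ℝ))
    intervalIntegrable_const c hF hb hc hlim

/-- The same with the pointwise sum written as `tsum`: `∫₀^a Σ_i F i = Σ_i ∫₀^a F i`. [folklore] -/
theorem integral_tsum_of_dominated [CompleteSpace E] {ι : Type*} [Countable ι] (F : ι → ℝ → E) {a : ℝ}
    (ha : 0 ≤ a)
    (c : ι → ℝ) (hF : ∀ i, ContinuousOn (F i) (Icc 0 a)) (hb : ∀ i, ∀ x ∈ Icc 0 a, ‖F i x‖ ≤ c i)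
    (hc : Summable c) :
    ∫ x in (0 : ℝ)..a, ∑' i, F i x = ∑' i, ∫ x in (0 : ℝ)..a, F i x :=
  (hasSum_integral_of_dominated ha c hF hb hc fun x hx =>
    (Summable.of_norm_bounded hc fun i => hb i x hx).hasSum).tsum_eq.symm

/-- `∫₀^a x^{−1/2} dx = 2a^{1/2}`: the weight of [Balaban1988RG2Cluster] (2.7) is integrable at `0` (used at
`a ≥ 0`; Mathlib's conventions for `x ^ r` at `x ≤ 0` make the identity unconditional). [folklore] -/
theorem integral_rpow_neg_half (a : ℝ) :
    ∫ x in (0 : ℝ)..a, x ^ (-(1 / 2 : ℝ)) = 2 * a ^ (1 / 2 : ℝ) := by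
  rw [integral_rpow (Or.inl (by norm_num))]
  have h1 : -(1 / 2 : ℝ) + 1 = 1 / 2 := by norm_num
  rw [h1, Real.zero_rpow (by norm_num)]
  ring

/-- The weighted per-term bound: `‖∫₀^a x^{−1/2} • g x dx‖ ≤ 2a^{1/2}·C` whenever `‖g x‖ ≤ C` on `[0,a]` — no
integrability of `g` is needed (Mathlib's `norm_integral_le_of_norm_le`). [folklore] -/
theorem norm_integral_rpow_smul_le {g : ℝ → E} {a C : ℝ} (ha : 0 ≤ a) (hg : ∀ x ∈ Icc 0 a, ‖g x‖ ≤ C) :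
    ‖∫ x in (0 : ℝ)..a, x ^ (-(1 / 2 : ℝ)) • g x‖ ≤ 2 * a ^ (1 / 2 : ℝ) * C := by
  have hC : 0 ≤ C := (norm_nonneg _).trans (hg 0 ⟨le_rfl, ha⟩)
  have h := intervalIntegral.norm_integral_le_of_norm_le (f := fun x => x ^ (-(1 / 2 : ℝ)) • g x)
    (g := fun x => C * x ^ (-(1 / 2 : ℝ))) (μ := volume) ha
    (Filter.Eventually.of_forall fun x hx => by
      rw [norm_smul, Real.norm_eq_abs, abs_of_nonneg (Real.rpow_nonneg hx.1.le _), mul_comm]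
      exact mul_le_mul_of_nonneg_right (hg x ⟨hx.1.le, hx.2⟩) (Real.rpow_nonneg hx.1.le _))
    ((intervalIntegrable_rpow' (by norm_num)).const_mul C)
  calc ‖∫ x in (0 : ℝ)..a, x ^ (-(1 / 2 : ℝ)) • g x‖ ≤ ∫ x in (0 : ℝ)..a, C * x ^ (-(1 / 2 : ℝ)) := h
    _ = 2 * a ^ (1 / 2 : ℝ) * C := by
        rw [intervalIntegral.integral_const_mul, integral_rpow_neg_half a]; ring

end interchange

/-! ## §2. The leaf, typed: clauses (α) representation and (β) continuity, next to (γ) = `B10LogDet63.G3WalkBound` -/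
section leaf

variable {D : LocDomainSys} {Q : Type} [DecidableEq Q] {S : Type} {Φ : Type*}

/-- **Clause (α) — REPRESENTATION on the compact x-interval** (cell GAPS C-adv4-61; G-IF-10 / G-B10-12 (i)): for every
`x ∈ [0, a]` (`a = 2γ₁` for (63), `a = γ₁` for [Balaban1988RG2Cluster] (2.7) — NOT `[0, ∞)`), every site `b` and every
configuration `φ` of the set `𝒰` on which the expansion is claimed, the datum `R x b φ` — the diagonal resolvent entry
`(C*Δ_k(U)C + xI)⁻¹(b,b)`, or its difference with the `U_{k+1} = 1` entry — IS the sum of its walk terms, level by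
level: `Σ_n Σ_{ω : |ω| = n, ω from the cube of b} term x b ω φ = R x b φ`.  Printed support: p. 272 *"The operator G̃₃(x)
has the same properties as G̃₂, especially it can be represented by a generalized random walk expansion"* (by analogy
with [5] Sect. B–E; unwritten).  Hypothesis only; nothing of the series is asserted.
[cite: Balaban1985UV3, p.272 (after (63))] -/
def G3Rep (nbrs : Q → Finset Q) (cube : S → Q) (term : ℝ → S → List Q → Φ → ℂ) (R : ℝ → S → Φ → ℂ)
    (𝒰 : Set Φ) (a : ℝ) : Prop :=
  ∀ x ∈ Icc (0 : ℝ) a, ∀ (b : S), ∀ φ ∈ 𝒰,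
    HasSum (fun n : ℕ => ∑ ω ∈ B9Thm37Sum.walksFrom nbrs n (cube b), term x b ω φ) (R x b φ)

/-- **Clause (β) — CONTINUITY IN x** (cell GAPS C-adv4-61 (2)): every walk term `x ↦ term x b ω φ` is continuous on
`[0, a]` for `φ` in the space of its localization domain.  For the print's terms — finite products of localized
inverses `(x·(non-negative, bounded, almost local operator) + G̃₂-type operator)⁻¹` sandwiched by x-independent bounded
operators (p. 272, [5] (3.183)–(3.185)) — this is the continuity of a resolvent in `x ≥ 0`, see §5; typed as a
hypothesis because the terms themselves are not constructed. [cite: Balaban1985UV3, p.272 (after (63))] -/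
def G3Cont (D : LocDomainSys) (nbrs : Q → Finset Q) (cube : S → Q) (dom : S → List Q → D.Dom) (sp : D.Dom → Set Φ)
    (term : ℝ → S → List Q → Φ → ℂ) (a : ℝ) : Prop :=
  ∀ (b : S) (n : ℕ) (ω : List Q), ω ∈ B9Thm37Sum.walksFrom nbrs n (cube b) → ∀ φ ∈ sp (dom b ω),
    ContinuousOn (fun x => term x b ω φ) (Icc 0 a)

end leaf

/-! ## §2b. (α) level by level versus over all walks at once -/
section sigma

variable {D : LocDomainSys} {Q : Type} [DecidableEq Q] {S : Type} {Φ : Type*}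
  {nbrs : Q → Finset Q} {cube : S → Q} {dom : S → List Q → D.Dom} {sp : D.Dom → Set Φ}
  {Dg : ℕ} {K q r a : ℝ} {term : ℝ → S → List Q → Φ → ℂ} {R : ℝ → S → Φ → ℂ} {𝒰 : Set Φ}

/-- Each level fibre of the type of all walks is finite: the level-`n` walk sum is a `HasSum` over the fibre.
[folklore] -/
theorem hasSum_fibre (nbrs : Q → Finset Q) (cube : S → Q) (term : ℝ → S → List Q → Φ → ℂ) (x : ℝ) (b : S)
    (φ : Φ) (n : ℕ) :
    HasSum (fun ω : ↥(B9Thm37Sum.walksFrom nbrs n (cube b)) => term x b (ω : List Q) φ)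
      (∑ ω ∈ B9Thm37Sum.walksFrom nbrs n (cube b), term x b ω φ) := by
  rw [← Finset.sum_coe_sort (B9Thm37Sum.walksFrom nbrs n (cube b)) (fun ω => term x b ω φ)]
  exact hasSum_fintype _

/-- A representation as ONE unconditional sum over the type of ALL walks from the cube of `b` (fibred by the number
of steps; the referee's `(C*Δ_kC + xI)⁻¹(b,b′) = Σ_ω term_ω(x)`) implies the level-wise representation (α): the
fibres are finite (`HasSum.sigma`); no bound is needed. [folklore] -/
theorem g3Rep_of_hasSum_sigma
    (h : ∀ x ∈ Icc (0 : ℝ) a, ∀ (b : S), ∀ φ ∈ 𝒰,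
      HasSum (fun p : (Σ n : ℕ, ↥(B9Thm37Sum.walksFrom nbrs n (cube b))) => term x b (p.2 : List Q) φ)
        (R x b φ)) :
    G3Rep nbrs cube term R 𝒰 a :=
  fun x hx b φ hφ => (h x hx b φ hφ).sigma fun n => hasSum_fibre nbrs cube term x b φ n

/-- Under (γ) with `r ≥ 0` (`≤ Dg` neighbours, `Dg·q < 1`) the walk terms of a configuration in every `sp X` are
ABSOLUTELY summable over the type of all walks: `‖term x b ω‖ ≤ K q^{|ω|}`, `#{|ω| = n} ≤ Dgⁿ`. [folklore] -/
theorem summable_sigma_of_walkBound (hD : ∀ c, (nbrs c).card ≤ Dg) (hK : 0 ≤ K) (hq : 0 ≤ q) (hDq : Dg * q < 1)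
    (hr : 0 ≤ r) (hbd : B10LogDet63.G3WalkBound D nbrs cube dom sp term K q r a) {x : ℝ} (hx : x ∈ Icc (0 : ℝ) a)
    (b : S) {φ : Φ} (hφ : ∀ X, φ ∈ sp X) :
    Summable (fun p : (Σ n : ℕ, ↥(B9Thm37Sum.walksFrom nbrs n (cube b))) => term x b (p.2 : List Q) φ) := by
  have hDq0 : 0 ≤ (Dg : ℝ) * q := by positivity
  have hpt : ∀ p : (Σ n : ℕ, ↥(B9Thm37Sum.walksFrom nbrs n (cube b))),
      ‖term x b (p.2 : List Q) φ‖ ≤ K * q ^ p.1 := by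
    rintro ⟨n, ω, hω⟩
    have h1 := hbd x hx b n ω φ hω (hφ _)
    have h2 : Real.exp (-(r * D.dj (dom b ω))) ≤ 1 :=
      Real.exp_le_one_iff.2 (neg_nonpos.2 (mul_nonneg hr (D.dj_nonneg _)))
    calc ‖term x b ω φ‖ ≤ K * q ^ n * Real.exp (-(r * D.dj (dom b ω))) := h1
      _ ≤ K * q ^ n * 1 := mul_le_mul_of_nonneg_left h2 (by positivity)
      _ = K * q ^ n := mul_one _
  have hmaj : Summable (fun p : (Σ n : ℕ, ↥(B9Thm37Sum.walksFrom nbrs n (cube b))) => K * q ^ p.1) := by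
    refine (summable_sigma_of_nonneg fun p => by positivity).2 ⟨fun n => (hasSum_fintype _).summable, ?_⟩
    simp only [tsum_fintype, Finset.sum_const, Finset.card_univ, Fintype.card_coe, nsmul_eq_mul]
    refine Summable.of_nonneg_of_le (fun n => by positivity) (fun n => ?_)
      ((summable_geometric_of_lt_one hDq0 hDq).mul_left K)
    calc ((B9Thm37Sum.walksFrom nbrs n (cube b)).card : ℝ) * (K * q ^ n)
        ≤ (Dg : ℝ) ^ n * (K * q ^ n) := by
          refine mul_le_mul_of_nonneg_right ?_ (by positivity)
          exact_mod_cast B9Thm37Sum.card_walksFrom_le nbrs hD n (cube b)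
      _ = K * (Dg * q) ^ n := by rw [mul_pow]; ring
  exact Summable.of_norm_bounded hmaj hpt

/-- **(α) level-wise ⟺ (α) over all walks, under (γ)**: given the x-uniform bound (γ) with `r ≥ 0` (`≤ Dg`
neighbours, `Dg·q < 1`), the level-wise representation `G3Rep` yields the representation as one unconditional sum
over all walks (`HasSum.sigma_of_hasSum` + `summable_sigma_of_walkBound`); with `g3Rep_of_hasSum_sigma` the two
typings of clause (α) are equivalent where the leaf is consumed, and the file keeps the formally weaker level-wise
one. [folklore] -/
theorem hasSum_sigma_of_g3Rep (hD : ∀ c, (nbrs c).card ≤ Dg) (hK : 0 ≤ K) (hq : 0 ≤ q) (hDq : Dg * q < 1)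
    (hr : 0 ≤ r) (hbd : B10LogDet63.G3WalkBound D nbrs cube dom sp term K q r a)
    (hrep : G3Rep nbrs cube term R 𝒰 a) {x : ℝ} (hx : x ∈ Icc (0 : ℝ) a) (b : S) {φ : Φ} (hφ𝒰 : φ ∈ 𝒰)
    (hφ : ∀ X, φ ∈ sp X) :
    HasSum (fun p : (Σ n : ℕ, ↥(B9Thm37Sum.walksFrom nbrs n (cube b))) => term x b (p.2 : List Q) φ)
      (R x b φ) :=
  (hrep x hx b φ hφ𝒰).sigma_of_hasSum (fun n => hasSum_fibre nbrs cube term x b φ n)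
    (summable_sigma_of_walkBound hD hK hq hDq hr hbd hx b hφ)

end sigma

/-! ## §3. Consequences: the localized pieces commute with the x-integral; the integrated resolvent IS the sum of the
integrated localized pieces -/
section consequences

variable {D : LocDomainSys} [DecidableEq D.Dom] {Q : Type} [DecidableEq Q] {S : Type} [Fintype S] {Φ : Type*}
  {nbrs : Q → Finset Q} {cube : S → Q} {dom : S → List Q → D.Dom} {cubes : D.Dom → Finset Q} {sp : D.Dom → Set Φ}
  {Dg V : ℕ} {K q r a : ℝ} {term : ℝ → S → List Q → Φ → ℂ} {R : ℝ → S → Φ → ℂ} {𝒰 : Set Φ} {w : ℝ → ℝ}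

/-- Under (β) the level-`n` part of the piece localized in `X` is continuous in `x` on `[0,a]` on `sp X` (a finite sum
of continuous terms). [folklore] -/
theorem continuousOn_level (hcont : G3Cont D nbrs cube dom sp term a) (X : D.Dom) (n : ℕ) {φ : Φ}
    (hφ : φ ∈ sp X) :
    ContinuousOn (fun x => B10LogDet63.level nbrs cube dom (term x) X n φ) (Icc 0 a) := by
  unfold B10LogDet63.level
  refine continuousOn_finsetSum _ fun b _ => continuousOn_finsetSum _ fun ω hω => ?_
  rw [mem_filter] at hω
  exact hcont b n ω hω.1 φ (hω.2 ▸ hφ)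

/-- Under (β)+(γ) (and the counting hypotheses of `B10LogDet63.norm_level_le`, `Dg·q < 1`) the localized piece
`x ↦ Elog(term x) X φ` is continuous on `[0,a]` on `sp X`: uniform limit of the continuous partial sums
(`continuousOn_tsum` with the geometric level bounds). [folklore] -/
theorem continuousOn_Elog (hD : ∀ c, (nbrs c).card ≤ Dg)
    (hV : ∀ c : Q, (univ.filter fun b : S => cube b = c).card ≤ V)
    (hstart : ∀ b n ω, ω ∈ B9Thm37Sum.walksFrom nbrs n (cube b) → cube b ∈ cubes (dom b ω))
    (hK : 0 ≤ K) (hq : 0 ≤ q) (hDq : Dg * q < 1)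
    (hbd : B10LogDet63.G3WalkBound D nbrs cube dom sp term K q r a) (hcont : G3Cont D nbrs cube dom sp term a)
    (X : D.Dom) {φ : Φ} (hφ : φ ∈ sp X) :
    ContinuousOn (fun x => B10LogDet63.Elog nbrs cube dom (term x) X φ) (Icc 0 a) := by
  have hDq0 : 0 ≤ (Dg : ℝ) * q := by positivity
  unfold B10LogDet63.Elog
  refine continuousOn_tsum (f := fun n x => B10LogDet63.level nbrs cube dom (term x) X n φ)
    (fun n => continuousOn_level hcont X n hφ)
    ((summable_geometric_of_lt_one hDq0 hDq).mul_left (K * V * (cubes X).card * Real.exp (-(r * D.dj X))))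
    fun n x hx => ?_
  calc ‖B10LogDet63.level nbrs cube dom (term x) X n φ‖ ≤ _ :=
      B10LogDet63.norm_level_le hD hV hstart hK hq (hbd x hx) X n hφ
    _ = _ := by ring

/-- Under (β), at each level the x-integral with an interval-integrable scalar weight `w` passes inside the finite sum
over sites and walks: `level(∫₀^a w·term) X n = ∫₀^a w x · level(term x) X n dx` on `sp X`. [folklore] -/
theorem level_integral_smul_eq (hcont : G3Cont D nbrs cube dom sp term a) (ha : 0 ≤ a)
    (hw : IntervalIntegrable w volume 0 a) (X : D.Dom) (n : ℕ) {φ : Φ} (hφ : φ ∈ sp X) :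
    B10LogDet63.level nbrs cube dom (fun b ω φ => ∫ x in (0 : ℝ)..a, w x • term x b ω φ) X n φ
      = ∫ x in (0 : ℝ)..a, w x • B10LogDet63.level nbrs cube dom (term x) X n φ := by
  unfold B10LogDet63.level
  simp only [Finset.smul_sum]
  have hint : ∀ b, ∀ ω ∈ (B9Thm37Sum.walksFrom nbrs n (cube b)).filter (fun ω => dom b ω = X),
      IntervalIntegrable (fun x => w x • term x b ω φ) volume 0 a := by
    intro b ω hω
    rw [mem_filter] at hω
    refine hw.smul_continuousOn ?_
    rw [uIcc_of_le ha]
    exact hcont b n ω hω.1 φ (hω.2 ▸ hφ)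
  have hint' : ∀ b : S, IntervalIntegrable
      (fun x => ∑ ω ∈ (B9Thm37Sum.walksFrom nbrs n (cube b)).filter (fun ω => dom b ω = X),
        w x • term x b ω φ) volume 0 a := by
    intro b
    have h := IntervalIntegrable.sum ((B9Thm37Sum.walksFrom nbrs n (cube b)).filter (fun ω => dom b ω = X))
      (fun ω hω => hint b ω hω)
    rwa [Finset.sum_fn] at h
  rw [intervalIntegral.integral_finsetSum fun b _ => hint' b]
  exact Finset.sum_congr rfl fun b _ => (intervalIntegral.integral_finsetSum (hint b)).symm

/-- **The levels commute with the weighted x-integral, summed**: under (β)+(γ) (+ counting hypotheses, `Dg·q < 1`),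
`Σ_n ∫₀^a w·level(term x) X n dx = ∫₀^a w·Elog(term x) X dx` as a `HasSum` on `sp X` — dominated convergence with the
geometric level bounds `K·V·#cubes(X)·(Dg q)ⁿ·e^{−r d(X)}` of `B10LogDet63.norm_level_le`. [folklore] -/
theorem hasSum_integral_smul_level (hD : ∀ c, (nbrs c).card ≤ Dg)
    (hV : ∀ c : Q, (univ.filter fun b : S => cube b = c).card ≤ V)
    (hstart : ∀ b n ω, ω ∈ B9Thm37Sum.walksFrom nbrs n (cube b) → cube b ∈ cubes (dom b ω))
    (hK : 0 ≤ K) (hq : 0 ≤ q) (hDq : Dg * q < 1) (ha : 0 ≤ a) (hw : IntervalIntegrable w volume 0 a)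
    (hbd : B10LogDet63.G3WalkBound D nbrs cube dom sp term K q r a) (hcont : G3Cont D nbrs cube dom sp term a)
    (X : D.Dom) {φ : Φ} (hφ : φ ∈ sp X) :
    HasSum (fun n => ∫ x in (0 : ℝ)..a, w x • B10LogDet63.level nbrs cube dom (term x) X n φ)
      (∫ x in (0 : ℝ)..a, w x • B10LogDet63.Elog nbrs cube dom (term x) X φ) := by
  have hDq0 : 0 ≤ (Dg : ℝ) * q := by positivity
  refine hasSum_integral_smul_of_dominated (F := fun n x => B10LogDet63.level nbrs cube dom (term x) X n φ)
    (f := fun x => B10LogDet63.Elog nbrs cube dom (term x) X φ) ha hw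
    (fun n => K * V * (cubes X).card * Real.exp (-(r * D.dj X)) * (Dg * q) ^ n)
    (fun n => continuousOn_level hcont X n hφ) (fun n x hx => ?_)
    ((summable_geometric_of_lt_one hDq0 hDq).mul_left _) (fun x hx => ?_)
  · calc ‖B10LogDet63.level nbrs cube dom (term x) X n φ‖ ≤ _ :=
        B10LogDet63.norm_level_le hD hV hstart hK hq (hbd x hx) X n hφ
      _ = _ := by ring
  · unfold B10LogDet63.Elog
    exact (B10LogDet63.summable_level hD hV hstart hK hq hDq (hbd x hx) X hφ).hasSum

/-- **The localized piece commutes with the weighted x-integral**: under (β)+(γ) (+ counting hypotheses,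
`Dg·q < 1`), `Elog(∫₀^a w·term) X φ = ∫₀^a w x · Elog(term x) X φ dx` on `sp X` — the x-integrated localized term IS
the x-integral of the localized term. [folklore] -/
theorem Elog_integral_smul_eq (hD : ∀ c, (nbrs c).card ≤ Dg)
    (hV : ∀ c : Q, (univ.filter fun b : S => cube b = c).card ≤ V)
    (hstart : ∀ b n ω, ω ∈ B9Thm37Sum.walksFrom nbrs n (cube b) → cube b ∈ cubes (dom b ω))
    (hK : 0 ≤ K) (hq : 0 ≤ q) (hDq : Dg * q < 1) (ha : 0 ≤ a) (hw : IntervalIntegrable w volume 0 a)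
    (hbd : B10LogDet63.G3WalkBound D nbrs cube dom sp term K q r a) (hcont : G3Cont D nbrs cube dom sp term a)
    (X : D.Dom) {φ : Φ} (hφ : φ ∈ sp X) :
    B10LogDet63.Elog nbrs cube dom (fun b ω φ => ∫ x in (0 : ℝ)..a, w x • term x b ω φ) X φ
      = ∫ x in (0 : ℝ)..a, w x • B10LogDet63.Elog nbrs cube dom (term x) X φ := by
  calc B10LogDet63.Elog nbrs cube dom (fun b ω φ => ∫ x in (0 : ℝ)..a, w x • term x b ω φ) X φ
        = ∑' n, ∫ x in (0 : ℝ)..a, w x • B10LogDet63.level nbrs cube dom (term x) X n φ := by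
          unfold B10LogDet63.Elog
          exact tsum_congr fun n => level_integral_smul_eq hcont ha hw X n hφ
    _ = ∫ x in (0 : ℝ)..a, w x • B10LogDet63.Elog nbrs cube dom (term x) X φ :=
          (hasSum_integral_smul_level hD hV hstart hK hq hDq ha hw hbd hcont X hφ).tsum_eq

/-- Weight `w ≡ 1` ((63) of [Balaban1985UV3]): `level(∫₀^a term) X n = ∫₀^a level(term x) X n dx` on `sp X`, under
(β). [folklore] -/
theorem level_integral_eq (hcont : G3Cont D nbrs cube dom sp term a) (ha : 0 ≤ a) (X : D.Dom) (n : ℕ) {φ : Φ}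
    (hφ : φ ∈ sp X) :
    B10LogDet63.level nbrs cube dom (fun b ω φ => ∫ x in (0 : ℝ)..a, term x b ω φ) X n φ
      = ∫ x in (0 : ℝ)..a, B10LogDet63.level nbrs cube dom (term x) X n φ := by
  simpa only [one_smul] using
    level_integral_smul_eq hcont ha (w := fun _ => (1 : ℝ)) intervalIntegrable_const X n hφ

/-- Weight `w ≡ 1`: `Σ_n ∫₀^a level(term x) X n dx = ∫₀^a Elog(term x) X dx` as a `HasSum` on `sp X`, under (β)+(γ).
[folklore] -/
theorem hasSum_integral_level (hD : ∀ c, (nbrs c).card ≤ Dg)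
    (hV : ∀ c : Q, (univ.filter fun b : S => cube b = c).card ≤ V)
    (hstart : ∀ b n ω, ω ∈ B9Thm37Sum.walksFrom nbrs n (cube b) → cube b ∈ cubes (dom b ω))
    (hK : 0 ≤ K) (hq : 0 ≤ q) (hDq : Dg * q < 1) (ha : 0 ≤ a)
    (hbd : B10LogDet63.G3WalkBound D nbrs cube dom sp term K q r a) (hcont : G3Cont D nbrs cube dom sp term a)
    (X : D.Dom) {φ : Φ} (hφ : φ ∈ sp X) :
    HasSum (fun n => ∫ x in (0 : ℝ)..a, B10LogDet63.level nbrs cube dom (term x) X n φ)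
      (∫ x in (0 : ℝ)..a, B10LogDet63.Elog nbrs cube dom (term x) X φ) := by
  simpa only [one_smul] using hasSum_integral_smul_level hD hV hstart hK hq hDq ha (w := fun _ => (1 : ℝ))
    intervalIntegrable_const hbd hcont X hφ

/-- **"By the above formula this gives an expansion of the last integral in (63) into a sum of gauge invariant,
localized terms"** (p. 272), the piece-by-piece form: under (β)+(γ) the x-integrated localized term of `B10LogDet63`
(the object bounded by `B10LogDet63.logHalfBound_integral63`) IS the x-integral of the localized term:
`Elog(∫₀^a term) X φ = ∫₀^a Elog(term x) X φ dx` on `sp X`. [cite: Balaban1985UV3, p.272 (after (63))] -/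
theorem Elog_integral_eq (hD : ∀ c, (nbrs c).card ≤ Dg)
    (hV : ∀ c : Q, (univ.filter fun b : S => cube b = c).card ≤ V)
    (hstart : ∀ b n ω, ω ∈ B9Thm37Sum.walksFrom nbrs n (cube b) → cube b ∈ cubes (dom b ω))
    (hK : 0 ≤ K) (hq : 0 ≤ q) (hDq : Dg * q < 1) (ha : 0 ≤ a)
    (hbd : B10LogDet63.G3WalkBound D nbrs cube dom sp term K q r a) (hcont : G3Cont D nbrs cube dom sp term a)
    (X : D.Dom) {φ : Φ} (hφ : φ ∈ sp X) :
    B10LogDet63.Elog nbrs cube dom (fun b ω φ => ∫ x in (0 : ℝ)..a, term x b ω φ) X φ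
      = ∫ x in (0 : ℝ)..a, B10LogDet63.Elog nbrs cube dom (term x) X φ := by
  simpa only [one_smul] using Elog_integral_smul_eq hD hV hstart hK hq hDq ha (w := fun _ => (1 : ℝ))
    intervalIntegrable_const hbd hcont X hφ

omit [DecidableEq D.Dom] [Fintype S] in
/-- The level-`n` walk sum at one site is at most `K·(Dg·q)ⁿ` under (γ) with a non-negative rate `r` (the decay
factor `e^{−r d} ≤ 1` is dropped; the walk count `#walks ≤ Dgⁿ` is `B9Thm37Sum.card_walksFrom_le`), for a
configuration in every space `sp X`. [folklore] -/
theorem norm_sum_walks_le (hD : ∀ c, (nbrs c).card ≤ Dg) (hK : 0 ≤ K) (hq : 0 ≤ q) (hr : 0 ≤ r)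
    (hbd : B10LogDet63.G3WalkBound D nbrs cube dom sp term K q r a) {x : ℝ} (hx : x ∈ Icc (0 : ℝ) a)
    (b : S) (n : ℕ) {φ : Φ} (hφ : ∀ X, φ ∈ sp X) :
    ‖∑ ω ∈ B9Thm37Sum.walksFrom nbrs n (cube b), term x b ω φ‖ ≤ K * (Dg * q) ^ n := by
  calc ‖∑ ω ∈ B9Thm37Sum.walksFrom nbrs n (cube b), term x b ω φ‖
        ≤ ∑ ω ∈ B9Thm37Sum.walksFrom nbrs n (cube b), ‖term x b ω φ‖ := norm_sum_le _ _
    _ ≤ ∑ _ω ∈ B9Thm37Sum.walksFrom nbrs n (cube b), K * q ^ n := by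
        refine sum_le_sum fun ω hω => ?_
        have h1 := hbd x hx b n ω φ hω (hφ _)
        have h2 : Real.exp (-(r * D.dj (dom b ω))) ≤ 1 :=
          Real.exp_le_one_iff.2 (neg_nonpos.2 (mul_nonneg hr (D.dj_nonneg _)))
        calc ‖term x b ω φ‖ ≤ K * q ^ n * Real.exp (-(r * D.dj (dom b ω))) := h1
          _ ≤ K * q ^ n * 1 := mul_le_mul_of_nonneg_left h2 (by positivity)
          _ = K * q ^ n := mul_one _
    _ = (B9Thm37Sum.walksFrom nbrs n (cube b)).card * (K * q ^ n) := by rw [sum_const, nsmul_eq_mul]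
    _ ≤ (Dg : ℝ) ^ n * (K * q ^ n) := by
        refine mul_le_mul_of_nonneg_right ?_ (by positivity)
        exact_mod_cast B9Thm37Sum.card_walksFrom_le nbrs hD n (cube b)
    _ = K * (Dg * q) ^ n := by rw [mul_pow]; ring

omit [DecidableEq D.Dom] [Fintype S] in
/-- **Per site, weighted**: under (α)+(β)+(γ) (`Dg·q < 1`, `r ≥ 0`) the weighted x-integral of the resolvent datum IS
the level-by-level sum of the weighted x-integrals of its walk terms:
`Σ_n Σ_{|ω| = n} ∫₀^a w·term x b ω = ∫₀^a w·R x b` as a `HasSum`, for a configuration of `𝒰` lying in every `sp X`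
(for [Balaban1988RG2Cluster] (2.7): `w = x^{−1/2}`, `a = γ₁`). [cite: Balaban1988RG2Cluster, (2.7) p.13] -/
theorem hasSum_integral_smul_R (hD : ∀ c, (nbrs c).card ≤ Dg) (hK : 0 ≤ K) (hq : 0 ≤ q) (hDq : Dg * q < 1)
    (hr : 0 ≤ r) (ha : 0 ≤ a) (hw : IntervalIntegrable w volume 0 a)
    (hbd : B10LogDet63.G3WalkBound D nbrs cube dom sp term K q r a) (hcont : G3Cont D nbrs cube dom sp term a)
    (hrep : G3Rep nbrs cube term R 𝒰 a) (b : S) {φ : Φ} (hφ𝒰 : φ ∈ 𝒰) (hφ : ∀ X, φ ∈ sp X) :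
    HasSum (fun n => ∑ ω ∈ B9Thm37Sum.walksFrom nbrs n (cube b), ∫ x in (0 : ℝ)..a, w x • term x b ω φ)
      (∫ x in (0 : ℝ)..a, w x • R x b φ) := by
  have hDq0 : 0 ≤ (Dg : ℝ) * q := by positivity
  have hint : ∀ n, ∀ ω ∈ B9Thm37Sum.walksFrom nbrs n (cube b),
      IntervalIntegrable (fun x => w x • term x b ω φ) volume 0 a := fun n ω hω =>
    hw.smul_continuousOn (by rw [uIcc_of_le ha]; exact hcont b n ω hω φ (hφ _))
  have h := hasSum_integral_smul_of_dominated
    (F := fun n x => ∑ ω ∈ B9Thm37Sum.walksFrom nbrs n (cube b), term x b ω φ) (f := fun x => R x b φ) ha hw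
    (fun n => K * (Dg * q) ^ n)
    (fun n => continuousOn_finsetSum _ fun ω hω => hcont b n ω hω φ (hφ _))
    (fun n x hx => norm_sum_walks_le hD hK hq hr hbd hx b n hφ)
    ((summable_geometric_of_lt_one hDq0 hDq).mul_left K) (fun x hx => hrep x hx b φ hφ𝒰)
  have hfun : (fun n => ∑ ω ∈ B9Thm37Sum.walksFrom nbrs n (cube b), ∫ x in (0 : ℝ)..a, w x • term x b ω φ)
      = fun n => ∫ x in (0 : ℝ)..a, w x • ∑ ω ∈ B9Thm37Sum.walksFrom nbrs n (cube b), term x b ω φ := by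
    funext n
    rw [← intervalIntegral.integral_finsetSum (hint n)]
    refine intervalIntegral.integral_congr fun x _ => ?_
    show ∑ ω ∈ B9Thm37Sum.walksFrom nbrs n (cube b), w x • term x b ω φ
      = w x • ∑ ω ∈ B9Thm37Sum.walksFrom nbrs n (cube b), term x b ω φ
    exact Finset.smul_sum.symm
  rw [hfun]
  exact h

omit [DecidableEq D.Dom] [Fintype S] in
/-- **Per site** (w ≡ 1, (63)): under (α)+(β)+(γ), `Σ_n Σ_{|ω| = n} ∫₀^a term x b ω dx = ∫₀^a R x b dx` as a
`HasSum` — the x-integrated diagonal resolvent entry IS the sum of its x-integrated walk terms.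
[cite: Balaban1985UV3, p.272 (after (63))] -/
theorem hasSum_integral_R (hD : ∀ c, (nbrs c).card ≤ Dg) (hK : 0 ≤ K) (hq : 0 ≤ q) (hDq : Dg * q < 1)
    (hr : 0 ≤ r) (ha : 0 ≤ a)
    (hbd : B10LogDet63.G3WalkBound D nbrs cube dom sp term K q r a) (hcont : G3Cont D nbrs cube dom sp term a)
    (hrep : G3Rep nbrs cube term R 𝒰 a) (b : S) {φ : Φ} (hφ𝒰 : φ ∈ 𝒰) (hφ : ∀ X, φ ∈ sp X) :
    HasSum (fun n => ∑ ω ∈ B9Thm37Sum.walksFrom nbrs n (cube b), ∫ x in (0 : ℝ)..a, term x b ω φ)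
      (∫ x in (0 : ℝ)..a, R x b φ) := by
  simpa only [one_smul] using hasSum_integral_smul_R hD hK hq hDq hr ha (w := fun _ => (1 : ℝ))
    intervalIntegrable_const hbd hcont hrep b hφ𝒰 hφ

/-- **Pointwise resummation**: under (α)+(γ) (`Dg·q < 1`), at every `x ∈ [0,a]` the resolvent data summed over the
sites equal the localized pieces summed over the domains, `Σ_b R x b φ = Σ_X Elog(term x) X φ` — the representation
(α) read through `B10LogDet63.sum_Elog_eq` (*"Summing the expressions with the same localization X"* loses nothing).
[cite: Balaban1985UV3, p.272 (after (63)); p.262 (before (24))] -/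
theorem sum_R_eq_sum_Elog (hD : ∀ c, (nbrs c).card ≤ Dg)
    (hV : ∀ c : Q, (univ.filter fun b : S => cube b = c).card ≤ V)
    (hstart : ∀ b n ω, ω ∈ B9Thm37Sum.walksFrom nbrs n (cube b) → cube b ∈ cubes (dom b ω))
    (hK : 0 ≤ K) (hq : 0 ≤ q) (hDq : Dg * q < 1)
    (hbd : B10LogDet63.G3WalkBound D nbrs cube dom sp term K q r a) (hrep : G3Rep nbrs cube term R 𝒰 a)
    {x : ℝ} (hx : x ∈ Icc (0 : ℝ) a) {φ : Φ} (hφ𝒰 : φ ∈ 𝒰) (hφ : ∀ X, φ ∈ sp X) :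
    ∑ b : S, R x b φ = ∑ X : D.Dom, B10LogDet63.Elog nbrs cube dom (term x) X φ := by
  rw [B10LogDet63.sum_Elog_eq (term x) φ fun X =>
    B10LogDet63.summable_level hD hV hstart hK hq hDq (hbd x hx) X (hφ X)]
  exact ((hasSum_sum fun b _ => hrep x hx b φ hφ𝒰).tsum_eq).symm

/-- **The integrated resummation, weighted**: under (α)+(β)+(γ),
`∫₀^a w x · Σ_b R x b φ dx = Σ_X Elog(∫₀^a w·term) X φ` — the weighted x-integral of the site-summed resolvent data IS
the sum over localization domains of the weighted-x-integrated localized pieces ([Balaban1988RG2Cluster] (2.7):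
`w = x^{−1/2}`, `a = γ₁`; each piece then obeys `logHalfBound_integral27`). [cite: Balaban1988RG2Cluster, (2.7) p.13] -/
theorem integral_smul_sum_R_eq (hD : ∀ c, (nbrs c).card ≤ Dg)
    (hV : ∀ c : Q, (univ.filter fun b : S => cube b = c).card ≤ V)
    (hstart : ∀ b n ω, ω ∈ B9Thm37Sum.walksFrom nbrs n (cube b) → cube b ∈ cubes (dom b ω))
    (hK : 0 ≤ K) (hq : 0 ≤ q) (hDq : Dg * q < 1) (ha : 0 ≤ a) (hw : IntervalIntegrable w volume 0 a)
    (hbd : B10LogDet63.G3WalkBound D nbrs cube dom sp term K q r a) (hcont : G3Cont D nbrs cube dom sp term a)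
    (hrep : G3Rep nbrs cube term R 𝒰 a) {φ : Φ} (hφ𝒰 : φ ∈ 𝒰) (hφ : ∀ X, φ ∈ sp X) :
    ∫ x in (0 : ℝ)..a, w x • ∑ b : S, R x b φ
      = ∑ X : D.Dom, B10LogDet63.Elog nbrs cube dom (fun b ω φ => ∫ x in (0 : ℝ)..a, w x • term x b ω φ) X φ := by
  have h1 : ∫ x in (0 : ℝ)..a, w x • ∑ b : S, R x b φ
      = ∫ x in (0 : ℝ)..a, ∑ X : D.Dom, w x • B10LogDet63.Elog nbrs cube dom (term x) X φ := by
    refine intervalIntegral.integral_congr fun x hx => ?_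
    rw [uIcc_of_le ha] at hx
    show w x • ∑ b : S, R x b φ = ∑ X : D.Dom, w x • B10LogDet63.Elog nbrs cube dom (term x) X φ
    rw [sum_R_eq_sum_Elog hD hV hstart hK hq hDq hbd hrep hx hφ𝒰 hφ, Finset.smul_sum]
  rw [h1, intervalIntegral.integral_finsetSum fun X _ => ?_]
  · exact Finset.sum_congr rfl fun X _ =>
      (Elog_integral_smul_eq hD hV hstart hK hq hDq ha hw hbd hcont X (hφ X)).symm
  · exact hw.smul_continuousOn (by
      rw [uIcc_of_le ha]; exact continuousOn_Elog hD hV hstart hK hq hDq hbd hcont X (hφ X))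

/-- **"By the above formula this gives an expansion of the last integral in (63) into a sum of gauge invariant,
localized terms"** (p. 272), the integrated resummation (w ≡ 1): under (α)+(β)+(γ),
`∫₀^a Σ_b R x b φ dx = Σ_X Elog(∫₀^a term) X φ` — the x-integral of the site-summed diagonal resolvent data (the trace,
§4) IS the sum over localization domains of the x-integrated localized pieces, each of which obeys the per-cube shape
`B13.LogHalfBound` by `B10LogDet63.logHalfBound_integral63`. [cite: Balaban1985UV3, p.272 (after (63))] -/
theorem integral_sum_R_eq (hD : ∀ c, (nbrs c).card ≤ Dg)
    (hV : ∀ c : Q, (univ.filter fun b : S => cube b = c).card ≤ V)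
    (hstart : ∀ b n ω, ω ∈ B9Thm37Sum.walksFrom nbrs n (cube b) → cube b ∈ cubes (dom b ω))
    (hK : 0 ≤ K) (hq : 0 ≤ q) (hDq : Dg * q < 1) (ha : 0 ≤ a)
    (hbd : B10LogDet63.G3WalkBound D nbrs cube dom sp term K q r a) (hcont : G3Cont D nbrs cube dom sp term a)
    (hrep : G3Rep nbrs cube term R 𝒰 a) {φ : Φ} (hφ𝒰 : φ ∈ 𝒰) (hφ : ∀ X, φ ∈ sp X) :
    ∫ x in (0 : ℝ)..a, ∑ b : S, R x b φ
      = ∑ X : D.Dom, B10LogDet63.Elog nbrs cube dom (fun b ω φ => ∫ x in (0 : ℝ)..a, term x b ω φ) X φ := by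
  simpa only [one_smul] using integral_smul_sum_R_eq hD hV hstart hK hq hDq ha (w := fun _ => (1 : ℝ))
    intervalIntegrable_const hbd hcont hrep hφ𝒰 hφ

/-- **The (2.7)-weighted pieces obey the per-cube shape**: under (γ) on `[0,a]` (`a = γ₁`), the localized pieces of
the `x^{−1/2}`-weighted x-integrated terms obey `B13.LogHalfBound` with the same rate `r` and per-cube constant
`2a^{1/2}·K·V/(1 − Dg·q)` — the x-uniform bound costs the factor `∫₀^a x^{−1/2}dx = 2a^{1/2}` (companion of
`B10LogDet63.logHalfBound_integral63`, where w ≡ 1 costs the factor `a`). [cite: Balaban1988RG2Cluster, (2.7) p.13] -/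
theorem logHalfBound_integral27 (hD : ∀ c, (nbrs c).card ≤ Dg)
    (hV : ∀ c : Q, (univ.filter fun b : S => cube b = c).card ≤ V)
    (hstart : ∀ b n ω, ω ∈ B9Thm37Sum.walksFrom nbrs n (cube b) → cube b ∈ cubes (dom b ω))
    (hK : 0 ≤ K) (hq : 0 ≤ q) (hDq : Dg * q < 1) (ha : 0 ≤ a)
    (hbd : B10LogDet63.G3WalkBound D nbrs cube dom sp term K q r a) :
    B13.LogHalfBound D sp
      (B10LogDet63.Elog nbrs cube dom fun b ω φ => ∫ x in (0 : ℝ)..a, x ^ (-(1 / 2 : ℝ)) • term x b ω φ)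
      (fun X => (cubes X).card) (2 * a ^ (1 / 2 : ℝ) * K * V / (1 - Dg * q)) r := by
  have h2a : 0 ≤ 2 * a ^ (1 / 2 : ℝ) * K := by positivity
  refine B10LogDet63.logHalfBound_of_walks hD hV hstart h2a hq hDq fun b n ω φ hω hφ => ?_
  calc ‖∫ x in (0 : ℝ)..a, x ^ (-(1 / 2 : ℝ)) • term x b ω φ‖
        ≤ 2 * a ^ (1 / 2 : ℝ) * (K * q ^ n * Real.exp (-(r * D.dj (dom b ω)))) :=
          norm_integral_rpow_smul_le ha fun x hx => hbd x hx b n ω φ hω hφ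
    _ = 2 * a ^ (1 / 2 : ℝ) * K * q ^ n * Real.exp (-(r * D.dj (dom b ω))) := by ring

end consequences

/-! ## §4. The printed sentence at matrix level: the x-integrated resolvent trace is the sum of the x-integrated
localized pieces; (63) localized -/
section matrix

variable {D : LocDomainSys} [DecidableEq D.Dom] {Q : Type} [DecidableEq Q] {S : Type} [Fintype S] [DecidableEq S]
  {Φ : Type*} {nbrs : Q → Finset Q} {cube : S → Q} {dom : S → List Q → D.Dom} {cubes : D.Dom → Finset Q}
  {sp : D.Dom → Set Φ} {Dg V : ℕ} {K q r a : ℝ} {term : ℝ → S → List Q → Φ → ℂ} {𝒰 : Set Φ}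

/-- **The last integral in (63), expanded**: for a real symmetric matrix `T φ` indexed by the sites (the operator
`C*Δ_k(U)C` in the variables Ã) whose diagonal resolvent entries `(x·1 + T φ)⁻¹(b,b)` carry the representation (α) on
`[0,a]` with walk terms satisfying (β)+(γ): `∫₀^a Tr(x·1 + T φ)⁻¹ dx = Σ_X Elog(∫₀^a term) X φ`.
[cite: Balaban1985UV3, p.272 (after (63))] -/
theorem integral_trace_resolvent_eq_sum_Elog (T : Φ → Matrix S S ℝ) (hD : ∀ c, (nbrs c).card ≤ Dg)
    (hV : ∀ c : Q, (univ.filter fun b : S => cube b = c).card ≤ V)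
    (hstart : ∀ b n ω, ω ∈ B9Thm37Sum.walksFrom nbrs n (cube b) → cube b ∈ cubes (dom b ω))
    (hK : 0 ≤ K) (hq : 0 ≤ q) (hDq : Dg * q < 1) (ha : 0 ≤ a)
    (hbd : B10LogDet63.G3WalkBound D nbrs cube dom sp term K q r a) (hcont : G3Cont D nbrs cube dom sp term a)
    (hrep : G3Rep nbrs cube term (fun x b φ => (((x • (1 : Matrix S S ℝ) + T φ)⁻¹ b b : ℝ) : ℂ)) 𝒰 a)
    {φ : Φ} (hφ𝒰 : φ ∈ 𝒰) (hφ : ∀ X, φ ∈ sp X) :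
    (((∫ x in (0 : ℝ)..a, trace ((x • (1 : Matrix S S ℝ) + T φ)⁻¹) : ℝ)) : ℂ)
      = ∑ X : D.Dom, B10LogDet63.Elog nbrs cube dom (fun b ω φ => ∫ x in (0 : ℝ)..a, term x b ω φ) X φ := by
  rw [← integral_sum_R_eq hD hV hstart hK hq hDq ha hbd hcont hrep hφ𝒰 hφ, ← intervalIntegral.integral_ofReal]
  refine intervalIntegral.integral_congr fun x _ => ?_
  show ((trace ((x • (1 : Matrix S S ℝ) + T φ)⁻¹) : ℝ) : ℂ)
    = ∑ b : S, (((x • (1 : Matrix S S ℝ) + T φ)⁻¹ b b : ℝ) : ℂ)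
  rw [Matrix.trace, Complex.ofReal_sum]
  rfl

/-- **(63) LOCALIZED** — `B10LogDet63.matrix63` with its first term expanded: for `T φ ≻ 0` with every eigenvalue
`≤ γ₁` whose diagonal resolvent entries carry (α) on `[0, 2γ₁]` with walk terms satisfying (β)+(γ),
`−½ log det T φ = ½ Σ_X Elog(∫₀^{2γ₁} term) X φ − ½ log(2γ₁)·Tr I + Σ_{n≥1} ((−1)ⁿ/2n)(2γ₁)⁻ⁿ Tr (T φ)ⁿ` — the
log Z^{(k)} half as *"a sum of gauge invariant, localized terms"* plus the explicit power series (each localized piece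
obeys `B13.LogHalfBound` by `B10LogDet63.logHalfBound_integral63`; gauge invariance is not modelled).
[cite: Balaban1985UV3, (63) p.272 and the paragraph after it] -/
theorem matrix63_localized (T : Φ → Matrix S S ℝ) {φ : Φ} (hT : (T φ).PosDef) {γ₁ : ℝ} (hγ₁ : 0 < γ₁)
    (hγ : ∀ k, hT.1.eigenvalues k ≤ γ₁) (hD : ∀ c, (nbrs c).card ≤ Dg)
    (hV : ∀ c : Q, (univ.filter fun b : S => cube b = c).card ≤ V)
    (hstart : ∀ b n ω, ω ∈ B9Thm37Sum.walksFrom nbrs n (cube b) → cube b ∈ cubes (dom b ω))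
    (hK : 0 ≤ K) (hq : 0 ≤ q) (hDq : Dg * q < 1)
    (hbd : B10LogDet63.G3WalkBound D nbrs cube dom sp term K q r (2 * γ₁))
    (hcont : G3Cont D nbrs cube dom sp term (2 * γ₁))
    (hrep : G3Rep nbrs cube term (fun x b φ => (((x • (1 : Matrix S S ℝ) + T φ)⁻¹ b b : ℝ) : ℂ)) 𝒰 (2 * γ₁))
    (hφ𝒰 : φ ∈ 𝒰) (hφ : ∀ X, φ ∈ sp X) :
    ((-(1 / 2) * Real.log (T φ).det : ℝ) : ℂ)
      = (1 / 2 : ℂ) * ∑ X : D.Dom,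
            B10LogDet63.Elog nbrs cube dom (fun b ω φ => ∫ x in (0 : ℝ)..(2 * γ₁), term x b ω φ) X φ
        - (((1 / 2) * (Fintype.card S : ℝ) * Real.log (2 * γ₁) : ℝ) : ℂ)
        + ((∑' j : ℕ, (-1) ^ (j + 1) / (2 * ((j : ℝ) + 1)) * ((2 * γ₁) ^ (j + 1))⁻¹ * trace (T φ ^ (j + 1))
            : ℝ) : ℂ) := by
  rw [B10LogDet63.matrix63 hT hγ₁ hγ, ← integral_trace_resolvent_eq_sum_Elog T hD hV hstart hK hq hDq
    (by positivity) hbd hcont hrep hφ𝒰 hφ]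
  push_cast
  ring

omit [DecidableEq D.Dom] [Fintype S] [DecidableEq S] in
/-- **(2.7) LOCALIZED** — the tree's entrywise (2.7) `B13Sqrt27.invSqrt_apply_eq_split` (the `1/π` on the series
restored) with its compact-range integral expanded: if the resolvent entry `x ↦ (x·1 + T φ)⁻¹_{i(b) j(b)}` is the datum
of site `b` carrying (α) on `[0, γ₁]` with walk terms satisfying (β)+(γ) (`r ≥ 0`, `Dg·q < 1`), and `γ₁ >` every
eigenvalue of `T φ ≻ 0`, then
`(T φ)^{−1/2}_{i(b) j(b)} = π⁻¹ Σ_n Σ_{|ω|=n} ∫₀^{γ₁} x^{−1/2} term x b ω φ dx + π⁻¹ Σ_m ((−1)^m/(m+½)) γ₁^{−m−½} (T φ)^m_{i(b) j(b)}`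
— *"This yields an expansion of the integral above, hence an expansion of (C^{(k)})^{1/2} also"* (p. 13), for the
symmetric case; the weighted integrated pieces obey `logHalfBound_integral27`. [cite: Balaban1988RG2Cluster, (2.7) p.13] -/
theorem sqrt27_localized {m : Type*} [Fintype m] [DecidableEq m] (T : Φ → Matrix m m ℝ) (i j : S → m)
    {φ : Φ} (hT : (T φ).PosDef) {γ₁ : ℝ} (hγ : ∀ k, hT.1.eigenvalues k < γ₁)
    (hD : ∀ c, (nbrs c).card ≤ Dg) (hK : 0 ≤ K) (hq : 0 ≤ q) (hDq : Dg * q < 1) (hr : 0 ≤ r)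
    (hbd : B10LogDet63.G3WalkBound D nbrs cube dom sp term K q r γ₁) (hcont : G3Cont D nbrs cube dom sp term γ₁)
    (hrep : G3Rep nbrs cube term
      (fun x b φ => (((x • (1 : Matrix m m ℝ) + T φ)⁻¹ (i b) (j b) : ℝ) : ℂ)) 𝒰 γ₁)
    (b : S) (hφ𝒰 : φ ∈ 𝒰) (hφ : ∀ X, φ ∈ sp X) :
    ((cfc (fun t : ℝ => (Real.sqrt t)⁻¹) (T φ) (i b) (j b) : ℝ) : ℂ)
      = (π⁻¹ : ℝ) • (∑' n : ℕ, ∑ ω ∈ B9Thm37Sum.walksFrom nbrs n (cube b),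
            ∫ x in (0 : ℝ)..γ₁, x ^ (-(1 / 2 : ℝ)) • term x b ω φ)
        + ((π⁻¹ * ∑' l : ℕ, (-1) ^ l / ((l : ℝ) + 1 / 2) * (γ₁ ^ l * Real.sqrt γ₁)⁻¹ * (T φ ^ l) (i b) (j b)
            : ℝ) : ℂ) := by
  have hγpos : 0 < γ₁ := (hT.eigenvalues_pos (i b)).trans (hγ (i b))
  have hw : IntervalIntegrable (fun x : ℝ => x ^ (-(1 / 2 : ℝ))) volume 0 γ₁ :=
    intervalIntegral.intervalIntegrable_rpow' (by norm_num)
  have hsum := (hasSum_integral_smul_R hD hK hq hDq hr hγpos.le hw hbd hcont hrep b hφ𝒰 hφ).tsum_eq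
  rw [hsum, B13Sqrt27.invSqrt_apply_eq_split hT hγ (i b) (j b), Complex.ofReal_add, Complex.ofReal_mul,
    Complex.real_smul]
  congr 1
  congr 1
  rw [intervalIntegral.integral_of_le hγpos.le, ← integral_complex_ofReal]
  refine setIntegral_congr_fun measurableSet_Ioc fun x hx => ?_
  show (((Real.sqrt x)⁻¹ * (x • (1 : Matrix m m ℝ) + T φ)⁻¹ (i b) (j b) : ℝ) : ℂ)
    = (x ^ (-(1 / 2 : ℝ)) : ℝ) • (((x • (1 : Matrix m m ℝ) + T φ)⁻¹ (i b) (j b) : ℝ) : ℂ)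
  rw [Complex.real_smul, Complex.ofReal_mul, Real.sqrt_eq_rpow, ← Real.rpow_neg hx.1.le]

end matrix

/-! ## §5. Clause (β) is dischargeable for terms of the printed kind; non-vacuity of (α) -/
section discharge

variable {m : Type*} [Fintype m] [DecidableEq m]

omit [Fintype m] in
/-- `x·1 + T ≻ 0` for `T ≻ 0` and `x ≥ 0`. [folklore] -/
theorem posDef_smul_one_add (T : Matrix m m ℝ) (hT : T.PosDef) {x : ℝ} (hx : 0 ≤ x) :
    (x • (1 : Matrix m m ℝ) + T).PosDef := by
  have h1 : (x • (1 : Matrix m m ℝ)).PosSemidef := Matrix.PosSemidef.one.smul hx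
  simpa [add_comm] using hT.add_posSemidef h1

/-- **The resolvent is continuous in `x ≥ 0`** for a positive definite real symmetric `T`: `x ↦ (x·1 + T)⁻¹` is
continuous on `[0, ∞)` (entrywise `adjugate/det` with `det > 0`).  This is the mechanism behind clause (β) for the
print's terms (localized inverses of `x·(non-negative bounded operator) + positive operator`). [folklore] -/
theorem continuousOn_resolvent (T : Matrix m m ℝ) (hT : T.PosDef) :
    ContinuousOn (fun x : ℝ => (x • (1 : Matrix m m ℝ) + T)⁻¹) (Ici 0) := by
  have hA : Continuous (fun x : ℝ => x • (1 : Matrix m m ℝ) + T) :=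
    ((continuous_id (X := ℝ)).smul (continuous_const (y := (1 : Matrix m m ℝ)))).add continuous_const
  have hdet : ∀ x ∈ Ici (0 : ℝ), (x • (1 : Matrix m m ℝ) + T).det ≠ 0 :=
    fun x hx => (posDef_smul_one_add T hT hx).det_pos.ne'
  have h : ContinuousOn (fun x : ℝ => ((x • (1 : Matrix m m ℝ) + T).det)⁻¹ •
      (x • (1 : Matrix m m ℝ) + T).adjugate) (Ici 0) :=
    (((Continuous.matrix_det hA).continuousOn).inv₀ hdet).smul (Continuous.matrix_adjugate hA).continuousOn
  refine h.congr fun x _ => ?_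
  rw [Matrix.inv_def, Ring.inverse_eq_inv']

/-- The resolvent ENTRIES are continuous in `x ≥ 0`. [folklore] -/
theorem continuousOn_resolvent_apply (T : Matrix m m ℝ) (hT : T.PosDef) (i j : m) :
    ContinuousOn (fun x : ℝ => (x • (1 : Matrix m m ℝ) + T)⁻¹ i j) (Ici 0) :=
  (continuous_apply_apply i j).comp_continuousOn (continuousOn_resolvent T hT)

/-- Finite PRODUCTS of entries of such resolvents (the shape of a walk term: a product of localized inverses along the
walk) are continuous in `x ≥ 0`. [folklore] -/
theorem continuousOn_prod_resolvent_entries {ι : Type*} (s : Finset ι) (T : ι → Matrix m m ℝ)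
    (hT : ∀ l ∈ s, (T l).PosDef) (i j : ι → m) :
    ContinuousOn (fun x : ℝ => ∏ l ∈ s, (x • (1 : Matrix m m ℝ) + T l)⁻¹ (i l) (j l)) (Ici 0) :=
  continuousOn_finsetProd s fun l hl => continuousOn_resolvent_apply (T l) (hT l hl) (i l) (j l)

variable {D : LocDomainSys} {Q : Type} [DecidableEq Q] {S : Type} {Φ : Type*}
  {nbrs : Q → Finset Q} {cube : S → Q} {dom : S → List Q → D.Dom} {sp : D.Dom → Set Φ}
  {term : ℝ → S → List Q → Φ → ℂ}

/-- Terms continuous on the whole half-line `[0, ∞)` satisfy (β) on every `[0, a]`. [folklore] -/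
theorem g3Cont_of_Ici
    (h : ∀ (b : S) (n : ℕ) (ω : List Q), ω ∈ B9Thm37Sum.walksFrom nbrs n (cube b) → ∀ φ ∈ sp (dom b ω),
      ContinuousOn (fun x => term x b ω φ) (Ici 0)) (a : ℝ) :
    G3Cont D nbrs cube dom sp term a :=
  fun b n ω hω φ hφ => (h b n ω hω φ hφ).mono Icc_subset_Ici_self

/-- **(β) for terms of the printed kind**: if every walk term is an x-independent coefficient times a finite product
of entries of resolvents `(x·1 + T_l)⁻¹` of positive definite real symmetric matrices (the localized inverses along
the walk), then `G3Cont` holds on every `[0, a]`. [cite: Balaban1985UV3, p.272 (after (63))] -/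
theorem g3Cont_of_resolvent_products {ι : Type*} (s : S → List Q → Finset ι)
    (Tl : S → List Q → Φ → ι → Matrix m m ℝ) (i j : S → List Q → ι → m) (coef : S → List Q → Φ → ℂ)
    (hT : ∀ (b : S) (n : ℕ) (ω : List Q), ω ∈ B9Thm37Sum.walksFrom nbrs n (cube b) →
      ∀ φ ∈ sp (dom b ω), ∀ l ∈ s b ω, (Tl b ω φ l).PosDef)
    (hterm : ∀ x b ω φ, term x b ω φ = coef b ω φ *
      ((∏ l ∈ s b ω, (x • (1 : Matrix m m ℝ) + Tl b ω φ l)⁻¹ (i b ω l) (j b ω l) : ℝ) : ℂ)) (a : ℝ) :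
    G3Cont D nbrs cube dom sp term a := by
  refine g3Cont_of_Ici (fun b n ω hω φ hφ => ?_) a
  have hfun : (fun x => term x b ω φ) = fun x => coef b ω φ *
      ((∏ l ∈ s b ω, (x • (1 : Matrix m m ℝ) + Tl b ω φ l)⁻¹ (i b ω l) (j b ω l) : ℝ) : ℂ) := by
    funext x; exact hterm x b ω φ
  rw [hfun]
  exact continuousOn_const.mul (Complex.continuous_ofReal.comp_continuousOn
    (continuousOn_prod_resolvent_entries (s b ω) (Tl b ω φ) (hT b n ω hω φ hφ) (i b ω) (j b ω)))

/-- **Non-vacuity of (α)**: the one-term expansion — `term x b ω = R x b` on the trivial walk `ω = [cube b]` and `0` on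
every other walk — represents any datum `R` (level 0 carries everything; walks of `n ≥ 1` steps have `n + 1 ≥ 2`
entries, `B9Thm37Sum.head_length_of_mem_walksFrom`).  With this `term`, (β) is the continuity of `R` in `x` and (γ)
a bound `|R x b| ≤ K e^{−r d(dom b [cube b])}`: the three clauses are jointly satisfiable and carry no hidden
contradiction. [folklore] -/
theorem g3Rep_single (R : ℝ → S → Φ → ℂ) (𝒰 : Set Φ) (a : ℝ) :
    G3Rep nbrs cube (fun x b ω φ => if ω = [cube b] then R x b φ else 0) R 𝒰 a := by
  intro x _ b φ _
  have h0 : ∑ ω ∈ B9Thm37Sum.walksFrom nbrs 0 (cube b), (if ω = [cube b] then R x b φ else 0) = R x b φ := by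
    simp [B9Thm37Sum.walksFrom]
  have hne : ∀ n ≠ 0, ∑ ω ∈ B9Thm37Sum.walksFrom nbrs n (cube b), (if ω = [cube b] then R x b φ else 0) = 0 := by
    intro n hn
    refine Finset.sum_eq_zero fun ω hω => if_neg fun h => ?_
    have hl := (B9Thm37Sum.head_length_of_mem_walksFrom nbrs n (cube b) ω hω).2
    rw [h] at hl
    simp only [List.length_cons, List.length_nil] at hl
    omega
  have key := hasSum_single
    (f := fun n : ℕ => ∑ ω ∈ B9Thm37Sum.walksFrom nbrs n (cube b), (if ω = [cube b] then R x b φ else 0)) 0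
    (fun n hn => hne n hn)
  simp only [h0] at key
  exact key

end discharge

end Literature.MathematicalPhysics.QuantumFieldTheory.Balaban1983to89.B10Eq63Rep
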